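import Literature.Barriers.Schanuel.AlgebraicIndependenceOfLogarithmsRoyCategory
import Literature.Barriers.Schanuel.AlgebraicIndependenceOfLogarithmsRoyThm3
import HarnessLib

/-!
# Barrier (Schanuel): Roy 1992, §2 — Propositions 1–3 for Roy's category `𝒞`

Support file (everything proved; no named facts) for the deduction
`roy1992_thm1 → roy1992_thm2` ([Roy1992] §§2–3), continuing
`Literature.Barriers.Schanuel.AlgebraicIndependenceOfLogarithmsRoyCategory` (objects, morphisms,
kernels, cokernels, the image object and the functions `a, b, c, d, r, d₀, d₁` of §2). Here:

* the `ℚ̄`-structure `ℚ̄^{d₀} × ℚ̄^{d₁}` of `K^{d₀} × K^{d₁}` as a `ℚ̄`-subspace (`qPts`), the base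
  change `dim_K(K·S) = dim_ℚ̄ S` for subspaces of `ℚ̄`-points (`finrank_span_eq_of_le_qPts`, by
  flattening `K^{d₀} × K^{d₁} ≃ K^{d₀+d₁}` and `Roy1995.linearIndependent_algebraMap_pi`), the
  rationality criterion `dim_K T ≤ dim_ℚ̄ (T ∩ ℚ̄-points)` (`isQbarRational_iff_finrank_le`), and
  its consequences: intersections of rational subspaces are rational (`isQbarRational_inf`),
  ranges of morphisms are rational, injective morphisms reflect `ℚ̄`-points, preimages of
  rational subspaces under injective morphisms are rational (`IsBiRational.isQbarRational_comap`);
* the preimage object `X* = (K^{a₀} × K^{a₁}, i⁻¹(Y), i⁻¹(W), i⁻¹(V))` (`Obj.comapObj`) and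
  **Proposition 1** ("Any kernel of `𝒞` admits a cokernel in `𝒞` and, vice versa, any cokernel of
  `𝒞` admits a kernel in `𝒞`. The set of all kernels of `𝒞` and the set of its cokernels are closed
  under composition."): Roy's category as an arrow-free admissible category `Roy1992.cat :
  AdmissibleCat Obj` in the sense of
  `Literature.Barriers.Schanuel.AlgebraicIndependenceOfLogarithmsRoyThm3`;
* **Proposition 2** ("The function `a` is upper additive while `b, c, d, r, d₀`, and `d₁` are
  additive. These functions vanish on each object on which `r` vanishes."), packaged as
  `Obj.thm3Hyp : cat.Thm3Hyp fa fb fc fd fr` and `Obj.fd₁_additive`;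
* **Proposition 3** ("The function `a` is bounded above by `d₁`. For each object `X` of `𝒞`, there
  exists a cokernel `s : X → X'` with domain `X` such that `d₁(X') ≤ a(X)` and `b(X') = b(X)`."),
  `Obj.prop3`;
* **Theorem 1bis** (`Obj.statement1_of_thm1`: `roy1992_thm1` is Statement 1 of Theorem 3 for
  `(𝒞, a, b, c, d, r)`).

## What the source prints [Roy1992, §2, pp. 26–29]

* Proposition 1 (p. 27), Proposition 2 and its proof (p. 28: the exact sequences
  `0 → K^{d₀*} × 0 → K^{d₀} × 0 → K^{d₀'} × 0 → 0`, …, `0 → W* → W → W' → 0`, `0 → V* → V → V' → 0`,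
  `0 → Ω* → Ω → Ω' → 0`, `0 → Y* → Y → Y' → 0`, "From this we deduce that the functions
  `b, c, d, r, d₀, d₁` are additive. We also get the relations `i⁻¹(Y ∩ Ω) = Y* ∩ Ω*` and
  `s(Y ∩ Ω) ⊂ Y' ∩ Ω'`. These imply that the function `d₁ − a` is lower additive."),
  Proposition 3 and its proof (pp. 28–29: "let `s : K^{d₀} × K^{d₁} → K^{d₀} × K^{d₁'}` be a
  surjective `K`-linear mapping, of kernel `K·(V ∩ (0 × ℚ^{d₁}))`, satisfying
  `s(ℚ̄^{d₀} × 0) = ℚ̄^{d₀} × 0` and `s(0 × ℚ^{d₁}) = 0 × ℚ^{d₁'}` … we find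
  `d₁(X') = d₁' = d₁ − dim_K(V ∩ (0 × ℚ^{d₁})) ≤ d₁ − dim_ℚ(Y ∩ (0 × ωℚ^{d₁})) = a(X)`. Since
  `ker(s) ⊂ V`, we also get `b(X') = b(X)`.").
* Theorem 1bis (p. 27): "For each object `X` of `𝒞` with `b(X) ≠ 0`, there exists a cokernel
  `s : X → X'` of `𝒞` with domain `X` such that `b(X') + d(X') ≠ 0` and
  `(a(X') + c(X'))/(b(X') + d(X')) ≤ a(X)/b(X)`."

## References

* [Roy1992] D. Roy, *Matrices whose coefficients are linear forms in logarithms*, J. Number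
  Theory 41 (1992) 22–47: Notations (p. 24); §2 Propositions 1–3, Theorem 1bis (pp. 26–29).
-/

noncomputable section

namespace Literature.Barriers.Schanuel.Roy1992

open Module Submodule Complex

section PartB

variable {d₀ d₁ a₀ a₁ : ℕ}

local notation "ℚbar" => algebraicClosure ℚ ℂ

/-! ### Flattening `K^{d₀} × K^{d₁} ≃ K^{d₀ + d₁}` -/

/-- The coordinate identification `K^{d₀} × K^{d₁} ≃ K^{d₀+d₁}` (first the `d₀` coordinates, then
the `d₁`). [folklore] -/
def flat (d₀ d₁ : ℕ) : LinTangent d₀ d₁ ≃ₗ[ℂ] (Fin (d₀ + d₁) → ℂ) where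
  toFun v := Fin.append v.1 v.2
  invFun w := (fun i => w (Fin.castAdd d₁ i), fun j => w (Fin.natAdd d₀ j))
  map_add' v w := by
    funext k
    refine Fin.addCases (fun i => ?_) (fun j => ?_) k <;> simp
  map_smul' c v := by
    funext k
    refine Fin.addCases (fun i => ?_) (fun j => ?_) k <;> simp
  left_inv v := by
    ext i <;> simp
  right_inv w := by
    funext k
    refine Fin.addCases (fun i => ?_) (fun j => ?_) k <;> simp

/-- Coordinates of `flat v`. [folklore] -/
theorem forall_flat_mem_iff (S : Set ℂ) (v : LinTangent d₀ d₁) :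
    (∀ k, flat d₀ d₁ v k ∈ S) ↔ (∀ i, v.1 i ∈ S) ∧ ∀ j, v.2 j ∈ S := by
  constructor
  · intro h
    refine ⟨fun i => ?_, fun j => ?_⟩
    · simpa [flat] using h (Fin.castAdd d₁ i)
    · simpa [flat] using h (Fin.natAdd d₀ j)
  · rintro ⟨h1, h2⟩ k
    refine Fin.addCases (fun i => ?_) (fun j => ?_) k
    · simpa [flat] using h1 i
    · simpa [flat] using h2 j

/-- `ℚ̄`-points are the vectors with algebraic flat coordinates. [folklore] -/
theorem isQbarPoint_iff_flat (v : LinTangent d₀ d₁) :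
    IsQbarPoint v ↔ ∀ k, flat d₀ d₁ v k ∈ ℚbar :=
  (forall_flat_mem_iff _ v).symm

/-! ### The `ℚ̄`-structure `ℚ̄^{d₀} × ℚ̄^{d₁}` and base change -/

/-- The `ℚ̄`-points `ℚ̄^{d₀} × ℚ̄^{d₁}` of `K^{d₀} × K^{d₁}`, as a `ℚ̄`-subspace.
[cite: Roy1992, Notations (p. 24)] -/
def qPts (d₀ d₁ : ℕ) : Submodule ℚbar (LinTangent d₀ d₁) where
  carrier := {v | IsQbarPoint v}
  add_mem' := by
    rintro v w ⟨hv1, hv2⟩ ⟨hw1, hw2⟩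
    exact ⟨fun i => add_mem (hv1 i) (hw1 i), fun j => add_mem (hv2 j) (hw2 j)⟩
  zero_mem' := ⟨fun _ => zero_mem _, fun _ => zero_mem _⟩
  smul_mem' := by
    rintro c v ⟨hv1, hv2⟩
    refine ⟨fun i => ?_, fun j => ?_⟩
    · rw [Prod.smul_fst, Pi.smul_apply, IntermediateField.smul_def, smul_eq_mul]
      exact mul_mem c.2 (hv1 i)
    · rw [Prod.smul_snd, Pi.smul_apply, IntermediateField.smul_def, smul_eq_mul]
      exact mul_mem c.2 (hv2 j)

/-- Membership in `qPts`. [folklore] -/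
@[simp] theorem mem_qPts {v : LinTangent d₀ d₁} : v ∈ qPts d₀ d₁ ↔ IsQbarPoint v := Iff.rfl

/-- `ℚ̄^{d₀} × ℚ̄^{d₁}` is the image of the coordinatewise inclusion. [folklore] -/
theorem qPts_eq_range (d₀ d₁ : ℕ) :
    qPts d₀ d₁ = LinearMap.range ((incl ℚbar ℂ d₀).prodMap (incl ℚbar ℂ d₁)) := by
  ext v
  rw [mem_qPts, LinearMap.mem_range]
  constructor
  · rintro ⟨h1, h2⟩
    exact ⟨(fun i => ⟨v.1 i, h1 i⟩, fun j => ⟨v.2 j, h2 j⟩), rfl⟩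
  · rintro ⟨w, rfl⟩
    exact ⟨fun i => SetLike.coe_mem _, fun j => SetLike.coe_mem _⟩

/-- `ℚ̄^{d₀} × ℚ̄^{d₁}` is finite dimensional over `ℚ̄`. [folklore] -/
instance instFiniteQPts (d₀ d₁ : ℕ) : Module.Finite ℚbar (qPts d₀ d₁) := by
  rw [qPts_eq_range]
  infer_instance

/-- The standard basis vectors are `ℚ̄`-points, so `K · (ℚ̄^{d₀} × ℚ̄^{d₁}) = K^{d₀} × K^{d₁}`. [folklore] -/
theorem span_qPts_eq_top (d₀ d₁ : ℕ) :
    span ℂ (qPts d₀ d₁ : Set (LinTangent d₀ d₁)) = ⊤ := by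
  rw [eq_top_iff, ← ((Pi.basisFun ℂ (Fin d₀)).prod (Pi.basisFun ℂ (Fin d₁))).span_eq]
  refine span_mono ?_
  rintro _ ⟨k, rfl⟩
  rcases k with i | j
  · refine ⟨fun i' => ?_, fun j' => ?_⟩
    · rw [Basis.prod_apply_inl_fst, Pi.basisFun_apply]
      by_cases h : i' = i
      · subst h; simp
      · simp [h]
    · rw [Basis.prod_apply_inl_snd]
      exact zero_mem _
  · refine ⟨fun i' => ?_, fun j' => ?_⟩
    · rw [Basis.prod_apply_inr_fst]
      exact zero_mem _
    · rw [Basis.prod_apply_inr_snd, Pi.basisFun_apply]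
      by_cases h : j' = j
      · subst h; simp
      · simp [h]

/-- **Base change `ℚ̄ → K` on `K^{d₀} × K^{d₁}`**: a `ℚ̄`-subspace `S` of `ℚ̄`-points spans over `K`
a subspace of the same dimension, `dim_K (K·S) = dim_ℚ̄ S` (a `ℚ̄`-basis of `S` stays
`K`-independent, `Roy1995.linearIndependent_algebraMap_pi` after flattening). [folklore] -/
theorem finrank_span_eq_of_le_qPts (S : Submodule ℚbar (LinTangent d₀ d₁)) (hS : S ≤ qPts d₀ d₁) :
    finrank ℂ (span ℂ (S : Set (LinTangent d₀ d₁))) = finrank ℚbar S := by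
  haveI : Module.Finite ℚbar S :=
    Module.Finite.of_injective (Submodule.inclusion hS) (Submodule.inclusion_injective hS)
  set n := finrank ℚbar S
  let b : Basis (Fin n) ℚbar S := finBasis ℚbar S
  have hb : LinearIndependent ℚbar (fun i => (b i : LinTangent d₀ d₁)) :=
    b.linearIndependent.map' S.subtype S.ker_subtype
  -- the flattened vectors have algebraic coordinates
  let w : Fin n → Fin (d₀ + d₁) → ℚbar := fun i k =>
    ⟨flat d₀ d₁ (b i : LinTangent d₀ d₁) k, (isQbarPoint_iff_flat _).1 (hS (b i).2) k⟩
  have hw : incl ℚbar ℂ (d₀ + d₁) ∘ w = flat d₀ d₁ ∘ fun i => (b i : LinTangent d₀ d₁) := by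
    funext i k
    rfl
  have hwli : LinearIndependent ℚbar w := by
    apply LinearIndependent.of_comp (incl ℚbar ℂ (d₀ + d₁))
    rw [hw]
    exact hb.map' ((flat d₀ d₁).toLinearMap.restrictScalars ℚbar)
      (LinearMap.ker_eq_bot.2 (flat d₀ d₁).injective)
  have hK : LinearIndependent ℂ (incl ℚbar ℂ (d₀ + d₁) ∘ w) := linearIndependent_incl_comp hwli
  rw [hw] at hK
  have hbK : LinearIndependent ℂ (fun i => (b i : LinTangent d₀ d₁)) :=
    LinearIndependent.of_comp (flat d₀ d₁).toLinearMap hK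
  have hspan : span ℂ (S : Set (LinTangent d₀ d₁)) =
      span ℂ (Set.range fun i => (b i : LinTangent d₀ d₁)) := by
    refine le_antisymm ?_ (span_mono ?_)
    · rw [span_le]
      intro v hv
      have hT := eq_span_range_basis S b
      have hv' : v ∈ span ℚbar (Set.range fun i => (b i : LinTangent d₀ d₁)) := by
        rw [← hT]; exact hv
      exact span_le_restrictScalars ℚbar ℂ _ hv'
    · rintro _ ⟨i, rfl⟩
      exact (b i).2
  rw [hspan, finrank_span_eq_card hbK, Fintype.card_fin]

/-- `dim_ℚ̄ (ℚ̄^{d₀} × ℚ̄^{d₁}) = d₀ + d₁`. [folklore] -/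
theorem finrank_qPts (d₀ d₁ : ℕ) : finrank ℚbar (qPts d₀ d₁) = d₀ + d₁ := by
  rw [← finrank_span_eq_of_le_qPts (qPts d₀ d₁) le_rfl, span_qPts_eq_top, finrank_top,
    finrank_linTangent]

/-- The `ℚ̄`-points of a `K`-subspace `T`: `T ∩ (ℚ̄^{d₀} × ℚ̄^{d₁})` as a `ℚ̄`-subspace.
[cite: Roy1992, Notations (p. 24)] -/
def qOf (T : Submodule ℂ (LinTangent d₀ d₁)) : Submodule ℚbar (LinTangent d₀ d₁) :=
  T.restrictScalars ℚbar ⊓ qPts d₀ d₁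

/-- Membership in `qOf`. [folklore] -/
@[simp] theorem mem_qOf {T : Submodule ℂ (LinTangent d₀ d₁)} {v : LinTangent d₀ d₁} :
    v ∈ qOf T ↔ v ∈ T ∧ IsQbarPoint v := Iff.rfl

/-- `qOf T ⊆ ℚ̄^{d₀} × ℚ̄^{d₁}`. [folklore] -/
theorem qOf_le_qPts (T : Submodule ℂ (LinTangent d₀ d₁)) : qOf T ≤ qPts d₀ d₁ := inf_le_right

/-- `qOf T` is finite dimensional over `ℚ̄`. [folklore] -/
instance instFiniteQOf (T : Submodule ℂ (LinTangent d₀ d₁)) : Module.Finite ℚbar (qOf T) :=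
  Module.Finite.of_injective (Submodule.inclusion (qOf_le_qPts T))
    (Submodule.inclusion_injective _)

/-- The set of `ℚ̄`-points of `T` used in `IsQbarRational`. [folklore] -/
theorem coe_qOf (T : Submodule ℂ (LinTangent d₀ d₁)) :
    (qOf T : Set (LinTangent d₀ d₁)) = {v | v ∈ T ∧ IsQbarPoint v} := rfl

/-- `T` is rational over `ℚ̄` iff `T = K · qOf T`. [cite: Roy1992, Notations (p. 24)] -/
theorem isQbarRational_iff_eq_span (T : Submodule ℂ (LinTangent d₀ d₁)) :
    IsQbarRational T ↔ T = span ℂ (qOf T : Set (LinTangent d₀ d₁)) := Iff.rfl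

/-- `K · qOf T ⊆ T`. [folklore] -/
theorem span_qOf_le (T : Submodule ℂ (LinTangent d₀ d₁)) :
    span ℂ (qOf T : Set (LinTangent d₀ d₁)) ≤ T :=
  span_le.2 fun _ hv => hv.1

/-- `dim_ℚ̄ qOf T ≤ dim_K T`. [folklore] -/
theorem finrank_qOf_le (T : Submodule ℂ (LinTangent d₀ d₁)) :
    finrank ℚbar (qOf T) ≤ finrank ℂ T := by
  rw [← finrank_span_eq_of_le_qPts (qOf T) (qOf_le_qPts T)]
  exact Submodule.finrank_mono (span_qOf_le T)

/-- **Rationality by dimension**: `T` is rational over `ℚ̄` iff `dim_K T ≤ dim_ℚ̄ (qOf T)`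
(iff equality). [folklore] -/
theorem isQbarRational_iff_finrank_le (T : Submodule ℂ (LinTangent d₀ d₁)) :
    IsQbarRational T ↔ finrank ℂ T ≤ finrank ℚbar (qOf T) := by
  rw [← finrank_span_eq_of_le_qPts (qOf T) (qOf_le_qPts T), isQbarRational_iff_eq_span]
  constructor
  · intro h
    rw [← h]
  · intro h
    exact (Submodule.eq_of_le_of_finrank_le (span_qOf_le T) h).symm

/-- **The intersection of two subspaces rational over `ℚ̄` is rational over `ℚ̄`**
(`qOf (T₁ ∩ T₂) = qOf T₁ ∩ qOf T₂` and a dimension count with `K · (qOf T₁ + qOf T₂) ⊆ T₁ + T₂`).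
[folklore] -/
theorem isQbarRational_inf {T₁ T₂ : Submodule ℂ (LinTangent d₀ d₁)} (h₁ : IsQbarRational T₁)
    (h₂ : IsQbarRational T₂) : IsQbarRational (T₁ ⊓ T₂) := by
  rw [isQbarRational_iff_finrank_le] at h₁ h₂ ⊢
  have hq : qOf (T₁ ⊓ T₂) = qOf T₁ ⊓ qOf T₂ := by
    ext v
    simp only [mem_qOf, mem_inf]
    tauto
  have hsup : finrank ℚbar ↥(qOf T₁ ⊔ qOf T₂) ≤ finrank ℂ ↥(T₁ ⊔ T₂) := by
    rw [← finrank_span_eq_of_le_qPts _ (sup_le (qOf_le_qPts T₁) (qOf_le_qPts T₂))]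
    apply Submodule.finrank_mono
    rw [span_le]
    intro v hv
    obtain ⟨x, hx, y, hy, rfl⟩ := Submodule.mem_sup.1 hv
    exact Submodule.mem_sup.2 ⟨x, hx.1, y, hy.1, rfl⟩
  have e1 := Submodule.finrank_sup_add_finrank_inf_eq (qOf T₁) (qOf T₂)
  have e2 := Submodule.finrank_sup_add_finrank_inf_eq T₁ T₂
  rw [hq]
  omega

/-! ### Morphisms and `ℚ̄`-points: images, ranges, reflection, preimages -/

variable {f : LinTangent a₀ a₁ →ₗ[ℂ] LinTangent d₀ d₁}

/-- The range of a morphism is rational over `ℚ̄` (it is spanned by the images of the standard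
basis vectors, which are `ℚ̄`-points). [folklore] -/
theorem IsBiRational.isQbarRational_range (hf : IsBiRational f) :
    IsQbarRational (LinearMap.range f) := by
  rw [isQbarRational_iff_eq_span]
  have h : LinearMap.range f = span ℂ (f '' (qPts a₀ a₁ : Set (LinTangent a₀ a₁))) := by
    rw [← map_span, span_qPts_eq_top, ← LinearMap.range_eq_map]
  refine le_antisymm ?_ (span_qOf_le _)
  nth_rewrite 1 [h]
  refine span_mono ?_
  rintro _ ⟨v, hv, rfl⟩
  exact ⟨LinearMap.mem_range_self f v, hf.isQbarPoint hv⟩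

/-- **An injective morphism reflects `ℚ̄`-points**: if `f x ∈ ℚ̄^{d₀} × ℚ̄^{d₁}` then
`x ∈ ℚ̄^{a₀} × ℚ̄^{a₁}` (the `ℚ̄`-points of `range f` are the images of the `ℚ̄`-points, by
counting dimensions). [folklore] -/
theorem IsBiRational.isQbarPoint_of_apply (hf : IsBiRational f) (hinj : Function.Injective f)
    {x : LinTangent a₀ a₁} (hx : IsQbarPoint (f x)) : IsQbarPoint x := by
  set M : Submodule ℚbar (LinTangent d₀ d₁) := (qPts a₀ a₁).map (f.restrictScalars ℚbar) with hM
  have hMle : M ≤ qOf (LinearMap.range f) := by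
    rintro _ ⟨v, hv, rfl⟩
    exact ⟨LinearMap.mem_range_self f v, hf.isQbarPoint hv⟩
  have hfinM : finrank ℚbar M = a₀ + a₁ := by
    rw [hM, ← finrank_qPts a₀ a₁]
    exact (LinearEquiv.finrank_eq (Submodule.equivMapOfInjective _
      (show Function.Injective (f.restrictScalars ℚbar) from hinj) (qPts a₀ a₁))).symm
  have hfinR : finrank ℚbar (qOf (LinearMap.range f)) ≤ a₀ + a₁ := by
    refine (finrank_qOf_le _).trans ?_
    rw [LinearMap.finrank_range_of_inj hinj, finrank_linTangent]
  have hMeq : M = qOf (LinearMap.range f) :=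
    Submodule.eq_of_le_of_finrank_le hMle (by rw [hfinM]; exact hfinR)
  have hx' : f x ∈ qOf (LinearMap.range f) := ⟨LinearMap.mem_range_self f x, hx⟩
  rw [← hMeq, hM] at hx'
  obtain ⟨y, hy, hyx⟩ := hx'
  rw [← hinj hyx]
  exact hy

/-- **Preimages of rational subspaces under injective morphisms are rational over `ℚ̄`**
(`i⁻¹(W) = i⁻¹(W ∩ range i)`, `W ∩ range i` is rational, and its `ℚ̄`-points pull back to
`ℚ̄`-points). [cite: Roy1992, §2 Proposition 1 (p. 27)] -/
theorem IsBiRational.isQbarRational_comap (hf : IsBiRational f) (hinj : Function.Injective f)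
    {W : Submodule ℂ (LinTangent d₀ d₁)} (hW : IsQbarRational W) : IsQbarRational (W.comap f) := by
  have hR := isQbarRational_inf hW hf.isQbarRational_range
  rw [isQbarRational_iff_eq_span] at hR ⊢
  refine le_antisymm (fun x hx => ?_) (span_qOf_le _)
  have hfx : f x ∈ W ⊓ LinearMap.range f := ⟨hx, LinearMap.mem_range_self f x⟩
  rw [hR] at hfx
  have hle : span ℂ (qOf (W ⊓ LinearMap.range f) : Set (LinTangent d₀ d₁)) ≤
      (span ℂ (qOf (W.comap f) : Set (LinTangent a₀ a₁))).map f := by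
    rw [span_le]
    rintro v ⟨⟨hvW, ⟨y, rfl⟩⟩, hvq⟩
    exact ⟨y, subset_span ⟨hvW, hf.isQbarPoint_of_apply hinj hvq⟩, rfl⟩
  exact (Submodule.comap_map_eq_of_injective hinj _).le (hle hfx)

/-! ### The `ℚ`-block: a rational left inverse -/

/-- An injective map given by a matrix over `F` (acting on `K^a`) has a left inverse given by a
matrix over `F`. [folklore] -/
theorem exists_leftInverse_map {F K : Type*} [Field F] [Field K] [Algebra F K] {n a : ℕ}
    (B : Matrix (Fin n) (Fin a) F) (hB : Function.Injective (B.map (algebraMap F K)).mulVecLin) :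
    ∃ C : Matrix (Fin a) (Fin n) F,
      (C.map (algebraMap F K)) * (B.map (algebraMap F K)) = 1 := by
  have hBF : Function.Injective B.mulVecLin := by
    intro x y hxy
    apply incl_injective (F := F) (K := K) a
    apply hB
    rw [map_mulVec_incl, map_mulVec_incl, hxy]
  obtain ⟨g, hg⟩ := LinearMap.exists_leftInverse_of_injective B.mulVecLin
    (LinearMap.ker_eq_bot.2 hBF)
  refine ⟨LinearMap.toMatrix' g, ?_⟩
  rw [← Matrix.map_mul]
  have : LinearMap.toMatrix' g * B = 1 := by
    have h := congrArg LinearMap.toMatrix' hg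
    rw [LinearMap.toMatrix'_comp, LinearMap.toMatrix'_id] at h
    rwa [← Matrix.toLin'_apply', LinearMap.toMatrix'_toLin'] at h
  rw [this, Matrix.map_one _ (map_zero _) (map_one _)]

/-- Preimages of `ℚ`-subspaces of `ℚ̄^{d₀} × L^{d₁}` under injective morphisms are contained in
`ℚ̄^{a₀} × L^{a₁}` (first block: reflection of `ℚ̄`-points; second block: a rational left
inverse, `L` being a `ℚ`-subspace). [cite: Roy1992, §2 Proposition 1 (p. 27)] -/
theorem IsBiRational.isQbarLogSubspace_comap (hf : IsBiRational f) (hinj : Function.Injective f)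
    {Y : Submodule ℚ (LinTangent d₀ d₁)} (hY : IsQbarLogSubspace Y) :
    IsQbarLogSubspace (Y.comap (f.restrictScalars ℚ)) := by
  obtain ⟨B₀, B₁, hdec⟩ := exists_eq_prodMap_of_isBiRational hf
  intro y hy
  obtain ⟨h1, h2⟩ := hY _ hy
  refine ⟨fun i => ?_, fun j => ?_⟩
  · -- `f (y.1, 0) = (B₀ y.1, 0)` is a `ℚ̄`-point, hence so is `(y.1, 0)`
    have hpt : IsQbarPoint (f (y.1, 0)) := by
      have hf1 : (f (y.1, 0)).1 = (f y).1 := by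
        rw [hdec, LinearMap.prodMap_apply, LinearMap.prodMap_apply]
      refine ⟨fun k => ?_, fun k => ?_⟩
      · rw [hf1]; exact h1 k
      · rw [hdec, LinearMap.prodMap_apply, map_zero]
        exact zero_mem _
    exact (hf.isQbarPoint_of_apply hinj hpt).1 i
  · -- `y.2 = C₁ (B₁ y.2)` with `C₁` rational and `B₁ y.2 ∈ L^{d₁}`
    have hinj₁ : Function.Injective (B₁.map (algebraMap ℚ ℂ)).mulVecLin := by
      intro z z' hzz'
      have : f (0, z) = f (0, z') := by
        rw [hdec, LinearMap.prodMap_apply, LinearMap.prodMap_apply, hzz']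
      exact congrArg Prod.snd (hinj this)
    obtain ⟨C₁, hC₁⟩ := exists_leftInverse_map B₁ hinj₁
    have hy2 : y.2 = (C₁.map (algebraMap ℚ ℂ)).mulVec ((f y).2) := by
      rw [hdec]
      simp only [LinearMap.prodMap_apply, Matrix.mulVecLin_apply, Matrix.mulVec_mulVec, hC₁,
        Matrix.one_mulVec]
    rw [hy2]
    simp only [Matrix.mulVec, dotProduct, Matrix.map_apply]
    refine isAlgebraic_cexp_of_mem_logQSpan (sum_mem fun k _ => ?_)
    rw [Algebra.algebraMap_eq_smul_one, smul_mul_assoc, one_mul]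
    exact Submodule.smul_mem _ _ (Submodule.subset_span (h2 k))

/-! ### The preimage object of a kernel -/

namespace Obj

/-- **The preimage object** `X* = (K^{a₀} × K^{a₁}, i⁻¹(Y), i⁻¹(W), i⁻¹(V))` of an injective
morphism `i` (used in Proposition 1: "any cokernel of `𝒞` admits a kernel in `𝒞`").
[cite: Roy1992, §2 Proposition 1 (p. 27)] -/
def comapObj (X : Obj) (i : LinTangent a₀ a₁ →ₗ[ℂ] LinTangent X.d₀ X.d₁)
    (hinj : Function.Injective i) (hi : IsBiRational i) : Obj where
  d₀ := a₀
  d₁ := a₁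
  Y := X.Y.comap (i.restrictScalars ℚ)
  W := X.W.comap i
  V := X.V.comap i
  finite := by
    refine Module.Finite.of_injective
      ((i.restrictScalars ℚ).restrict (p := X.Y.comap (i.restrictScalars ℚ)) (q := X.Y)
        fun x hx => hx) ?_
    intro x y hxy
    apply Subtype.ext
    apply hinj
    have := congrArg Subtype.val hxy
    simpa using this
  isLog := hi.isQbarLogSubspace_comap hinj X.isLog
  isRat := hi.isQbarRational_comap hinj X.isRat
  hYV := fun _ hy => X.hYV hy
  hWV := Submodule.comap_mono X.hWV

/-- `X*` lives in `K^{a₀} × K^{a₁}`. [folklore] -/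
@[simp] theorem comapObj_d₀ (X : Obj) (i : LinTangent a₀ a₁ →ₗ[ℂ] LinTangent X.d₀ X.d₁)
    (hinj : Function.Injective i) (hi : IsBiRational i) : (X.comapObj i hinj hi).d₀ = a₀ := rfl

/-- `X*` lives in `K^{a₀} × K^{a₁}`. [folklore] -/
@[simp] theorem comapObj_d₁ (X : Obj) (i : LinTangent a₀ a₁ →ₗ[ℂ] LinTangent X.d₀ X.d₁)
    (hinj : Function.Injective i) (hi : IsBiRational i) : (X.comapObj i hinj hi).d₁ = a₁ := rfl

/-- `Y* = i⁻¹(Y)`. [cite: Roy1992, §2 (p. 26)] -/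
@[simp] theorem comapObj_Y (X : Obj) (i : LinTangent a₀ a₁ →ₗ[ℂ] LinTangent X.d₀ X.d₁)
    (hinj : Function.Injective i) (hi : IsBiRational i) :
    (X.comapObj i hinj hi).Y = X.Y.comap (i.restrictScalars ℚ) := rfl

/-- `W* = i⁻¹(W)`. [cite: Roy1992, §2 (p. 26)] -/
@[simp] theorem comapObj_W (X : Obj) (i : LinTangent a₀ a₁ →ₗ[ℂ] LinTangent X.d₀ X.d₁)
    (hinj : Function.Injective i) (hi : IsBiRational i) :
    (X.comapObj i hinj hi).W = X.W.comap i := rfl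

/-- `V* = i⁻¹(V)`. [cite: Roy1992, §2 (p. 26)] -/
@[simp] theorem comapObj_V (X : Obj) (i : LinTangent a₀ a₁ →ₗ[ℂ] LinTangent X.d₀ X.d₁)
    (hinj : Function.Injective i) (hi : IsBiRational i) :
    (X.comapObj i hinj hi).V = X.V.comap i := rfl

/-- `(X*, X, i)` is a kernel for every injective morphism `i`. [cite: Roy1992, §2 Proposition 1 (p. 27)] -/
theorem isKerMap_comapObj (X : Obj) {i : LinTangent a₀ a₁ →ₗ[ℂ] LinTangent X.d₀ X.d₁}
    (hinj : Function.Injective i) (hi : IsBiRational i) : (X.comapObj i hinj hi).IsKerMap X i :=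
  ⟨hinj, hi, rfl, rfl, rfl⟩

end Obj

/-! ### Rational injections and the ranges of rational matrices -/

/-- **Every rational subspace is the range of a rational injection**: for an `F`-subspace
`T ⊆ F^n` there is an injective `K`-linear `K^a → K^n`, `a = dim_F T`, given by a matrix with
entries in `F` (columns: a basis of `T`), whose range is `spanK T`. [folklore] -/
theorem exists_injective_range_eq_spanK {F K : Type*} [Field F] [Field K] [Algebra F K] {n : ℕ}
    (T : Submodule F (Fin n → F)) :
    ∃ (a : ℕ) (B : Matrix (Fin n) (Fin a) F), a = finrank F T ∧
      Function.Injective (B.map (algebraMap F K)).mulVecLin ∧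
      LinearMap.range (B.map (algebraMap F K)).mulVecLin = spanK K T := by
  set τ := finrank F T
  let b : Basis (Fin τ) F T := finBasis F T
  have hb : LinearIndependent F (fun i => (b i : Fin n → F)) :=
    b.linearIndependent.map' T.subtype T.ker_subtype
  have hT : T = span F (Set.range fun i => (b i : Fin n → F)) := eq_span_range_basis T b
  let B : Matrix (Fin n) (Fin τ) F := Matrix.of fun r c => (b c : Fin n → F) r
  have hBlin : (B.map (algebraMap F K)).mulVecLin =
      Fintype.linearCombination K (incl F K n ∘ fun c => (b c : Fin n → F)) := by
    refine LinearMap.ext fun x => ?_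
    rw [Fintype.linearCombination_apply]
    funext r
    simp only [Matrix.mulVecLin_apply, Matrix.mulVec, dotProduct, Matrix.map_apply,
      Matrix.of_apply, Finset.sum_apply, Pi.smul_apply, Function.comp_apply, incl_apply,
      smul_eq_mul, B]
    exact Finset.sum_congr rfl fun c _ => mul_comm _ _
  have hrange : LinearMap.range (B.map (algebraMap F K)).mulVecLin = spanK K T := by
    rw [hBlin, Fintype.range_linearCombination, Set.range_comp, ← spanK_span, ← hT]
  have hli : LinearIndependent K (incl F K n ∘ fun c => (b c : Fin n → F)) :=
    linearIndependent_incl_comp hb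
  refine ⟨τ, B, rfl, ?_, hrange⟩
  -- injective: the range has dimension `τ`
  rw [← LinearMap.ker_eq_bot, ← Submodule.finrank_eq_zero]
  have h1 := LinearMap.finrank_range_add_finrank_ker (B.map (algebraMap F K)).mulVecLin
  rw [hBlin, Fintype.range_linearCombination, finrank_span_eq_card hli, Fintype.card_fin,
    finrank_fin_fun] at h1
  rw [hBlin]
  omega

/-- The range on `K^a` of a matrix with entries in `F` is the `K`-span of its range on `F^a`
(ranges of rational maps are rational). [folklore] -/
theorem range_mulVecLin_map {F K : Type*} [Field F] [Field K] [Algebra F K] {n a : ℕ}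
    (B : Matrix (Fin n) (Fin a) F) :
    LinearMap.range (B.map (algebraMap F K)).mulVecLin = spanK K (LinearMap.range B.mulVecLin) := by
  rw [Matrix.range_mulVecLin, Matrix.range_mulVecLin, spanK_span, ← Set.range_comp]
  congr 1

/-! ### Proposition 1: kernels have cokernels and cokernels have kernels -/

namespace Obj

/-- **Proposition 1, first half**: every kernel `(X*, X, i)` admits a cokernel `(X, X', s)` with
`Im(i) = ker(s)` (`Im(i) = S₀ × S₁` with `S₀` rational over `ℚ̄`, `S₁` rational over `ℚ`; take
`s = t₀ × t₁` with rational surjections `t₀, t₁` of kernels `S₀, S₁`).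
[cite: Roy1992, §2 Proposition 1 (p. 27)] -/
theorem IsKerMap.exists_coker {A X : Obj} {i : LinTangent A.d₀ A.d₁ →ₗ[ℂ] LinTangent X.d₀ X.d₁}
    (hi : A.IsKerMap X i) :
    ∃ (B : Obj) (s : LinTangent X.d₀ X.d₁ →ₗ[ℂ] LinTangent B.d₀ B.d₁),
      X.IsCokerMap B s ∧ LinearMap.range i = LinearMap.ker s := by
  obtain ⟨-, hbi, -, -, -⟩ := hi
  obtain ⟨B₀, B₁, hdec⟩ := exists_eq_prodMap_of_isBiRational hbi
  obtain ⟨e₀, T₀, -, hsurj₀, hker₀⟩ := exists_surjective_ker_eq_spanK (F := ℚbar) (K := ℂ)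
    (LinearMap.range B₀.mulVecLin)
  obtain ⟨e₁, T₁, -, hsurj₁, hker₁⟩ := exists_surjective_ker_eq_spanK (F := ℚ) (K := ℂ)
    (LinearMap.range B₁.mulVecLin)
  have hbr : IsBiRational ((T₀.map (algebraMap ℚbar ℂ)).mulVecLin.prodMap
      (T₁.map (algebraMap ℚ ℂ)).mulVecLin) := isBiRational_prodMap T₀ T₁
  have hs : IsAdmissible ((T₀.map (algebraMap ℚbar ℂ)).mulVecLin.prodMap
      (T₁.map (algebraMap ℚ ℂ)).mulVecLin) := by
    refine ⟨?_, hbr⟩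
    rw [LinearMap.coe_prodMap]
    exact hsurj₀.prodMap hsurj₁
  have hker : LinearMap.range i = LinearMap.ker ((T₀.map (algebraMap ℚbar ℂ)).mulVecLin.prodMap
      (T₁.map (algebraMap ℚ ℂ)).mulVecLin) := by
    rw [hdec, LinearMap.range_prodMap, LinearMap.ker_prodMap, hker₀, hker₁, range_mulVecLin_map,
      range_mulVecLin_map]
  exact ⟨X.mapObj _ hbr, _, X.isCokerMap_mapObj hs, hker⟩

/-- **Proposition 1, second half**: every cokernel `(X, X', s)` admits a kernel `(X*, X, i)` with
`Im(i) = ker(s)` (`ker(s) = S₀ × S₁` with `S₀, S₁` rational; take `i = i₀ × i₁` with rational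
injections onto `S₀, S₁` and `X*` the preimage object). [cite: Roy1992, §2 Proposition 1 (p. 27)] -/
theorem IsCokerMap.exists_ker {X B : Obj} {s : LinTangent X.d₀ X.d₁ →ₗ[ℂ] LinTangent B.d₀ B.d₁}
    (hs : X.IsCokerMap B s) :
    ∃ (A : Obj) (i : LinTangent A.d₀ A.d₁ →ₗ[ℂ] LinTangent X.d₀ X.d₁),
      A.IsKerMap X i ∧ LinearMap.range i = LinearMap.ker s := by
  obtain ⟨⟨-, hbi⟩, -, -, -⟩ := hs
  obtain ⟨A₀, A₁, hdec⟩ := exists_eq_prodMap_of_isBiRational hbi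
  obtain ⟨a₀, B₀, -, hinj₀, hrange₀⟩ := exists_injective_range_eq_spanK (F := ℚbar) (K := ℂ)
    (LinearMap.ker A₀.mulVecLin)
  obtain ⟨a₁, B₁, -, hinj₁, hrange₁⟩ := exists_injective_range_eq_spanK (F := ℚ) (K := ℂ)
    (LinearMap.ker A₁.mulVecLin)
  have hinj : Function.Injective
      ((B₀.map (algebraMap ℚbar ℂ)).mulVecLin.prodMap (B₁.map (algebraMap ℚ ℂ)).mulVecLin) := by
    rw [LinearMap.coe_prodMap]
    exact hinj₀.prodMap hinj₁
  have hbi' : IsBiRational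
      ((B₀.map (algebraMap ℚbar ℂ)).mulVecLin.prodMap (B₁.map (algebraMap ℚ ℂ)).mulVecLin) :=
    isBiRational_prodMap B₀ B₁
  have hrange : LinearMap.range
      ((B₀.map (algebraMap ℚbar ℂ)).mulVecLin.prodMap (B₁.map (algebraMap ℚ ℂ)).mulVecLin) =
      LinearMap.ker s := by
    rw [hdec, LinearMap.ker_prodMap, LinearMap.range_prodMap, hrange₀, hrange₁,
      ker_mulVecLin_map, ker_mulVecLin_map]
  exact ⟨X.comapObj _ hinj hbi', _, X.isKerMap_comapObj hinj hbi', hrange⟩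

end Obj

/-- **Roy's category `𝒞` is admissible** (Proposition 1): the arrow-free admissible category
(`Roy1992.AdmissibleCat`) whose kernels/cokernels are given by the maps `IsKerMap`/`IsCokerMap`
and whose exact triples `(X*, X, X')` are "a kernel `X* → X` admitting as cokernel a morphism
`X → X'`" (`Im(i) = ker(s)`). [cite: Roy1992, §2 Proposition 1 (p. 27) and §3 (p. 29)] -/
def cat : AdmissibleCat Obj where
  IsKer A X := ∃ i, A.IsKerMap X i
  IsCoker X B := ∃ s, X.IsCokerMap B s
  Exact A X B := ∃ (i : LinTangent A.d₀ A.d₁ →ₗ[ℂ] LinTangent X.d₀ X.d₁)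
    (s : LinTangent X.d₀ X.d₁ →ₗ[ℂ] LinTangent B.d₀ B.d₁),
    A.IsKerMap X i ∧ X.IsCokerMap B s ∧ LinearMap.range i = LinearMap.ker s
  isKer_refl X := ⟨_, X.isKerMap_id⟩
  isCoker_refl X := ⟨_, X.isCokerMap_id⟩
  isKer_trans := fun ⟨_, hi⟩ ⟨_, hj⟩ => ⟨_, hi.comp hj⟩
  isCoker_trans := fun ⟨_, hs⟩ ⟨_, ht⟩ => ⟨_, hs.comp ht⟩
  isKer_of_exact := fun ⟨i, _, hi, _, _⟩ => ⟨i, hi⟩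
  isCoker_of_exact := fun ⟨_, s, _, hs, _⟩ => ⟨s, hs⟩
  exists_exact_of_isKer := fun ⟨i, hi⟩ => by
    obtain ⟨B, s, hs, h⟩ := hi.exists_coker
    exact ⟨B, i, s, hi, hs, h⟩
  exists_exact_of_isCoker := fun ⟨s, hs⟩ => by
    obtain ⟨A, i, hi, h⟩ := hs.exists_ker
    exact ⟨A, i, s, hi, hs, h⟩

/-- Kernels of `𝒞`. [folklore] -/
theorem cat_isKer_iff (A X : Obj) : cat.IsKer A X ↔ ∃ i, A.IsKerMap X i := Iff.rfl

/-- Cokernels of `𝒞`. [folklore] -/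
theorem cat_isCoker_iff (X B : Obj) : cat.IsCoker X B ↔ ∃ s, X.IsCokerMap B s := Iff.rfl

/-- Exact triples of `𝒞`. [folklore] -/
theorem cat_exact_iff (A X B : Obj) :
    cat.Exact A X B ↔ ∃ (i : LinTangent A.d₀ A.d₁ →ₗ[ℂ] LinTangent X.d₀ X.d₁)
      (s : LinTangent X.d₀ X.d₁ →ₗ[ℂ] LinTangent B.d₀ B.d₁),
      A.IsKerMap X i ∧ X.IsCokerMap B s ∧ LinearMap.range i = LinearMap.ker s := Iff.rfl

end PartB

end Literature.Barriers.Schanuel.Roy1992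

namespace Literature.Barriers.Schanuel.Roy1992

open Module Submodule Complex

section PartC

variable {d₀ d₁ d₀' d₁' a₀ a₁ : ℕ}

local notation "ℚbar" => algebraicClosure ℚ ℂ

/-! ### Rank–nullity along an exact pair -/

/-- **Rank–nullity along an exact pair**: if `i` is injective with `Im(i) = ker(g)` then for every
finite-dimensional subspace `T`, `dim g(T) + dim i⁻¹(T) = dim T` (`i⁻¹(T) ≅ ker(g|_T)`).
[cite: Roy1992, §2 proof of Proposition 2 (p. 28)] -/
theorem finrank_map_add_finrank_comap {R M₀ M M' : Type*} [DivisionRing R] [AddCommGroup M₀]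
    [Module R M₀] [AddCommGroup M] [Module R M] [AddCommGroup M'] [Module R M']
    (i : M₀ →ₗ[R] M) (g : M →ₗ[R] M') (hi : Function.Injective i)
    (hex : LinearMap.range i = LinearMap.ker g) (T : Submodule R M) [Module.Finite R T] :
    finrank R (T.map g) + finrank R (T.comap i) = finrank R T := by
  have h := LinearMap.finrank_range_add_finrank_ker (g.domRestrict T)
  rw [LinearMap.range_domRestrict] at h
  rw [← h, add_right_inj]
  -- `i⁻¹(T) ≃ ker (g|_T)`
  let φ : T.comap i →ₗ[R] T := i.restrict fun x hx => hx
  have hφ : ∀ x, φ x ∈ LinearMap.ker (g.domRestrict T) := by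
    intro x
    rw [LinearMap.mem_ker, LinearMap.domRestrict_apply]
    have : i x ∈ LinearMap.ker g := hex ▸ LinearMap.mem_range_self i x
    exact this
  refine LinearEquiv.finrank_eq (LinearEquiv.ofBijective (φ.codRestrict _ hφ) ⟨?_, ?_⟩)
  · intro x y hxy
    apply Subtype.ext
    apply hi
    have := congrArg (fun z => ((z : LinearMap.ker (g.domRestrict T)) : T).1) hxy
    exact this
  · rintro ⟨⟨y, hyT⟩, hy⟩
    rw [LinearMap.mem_ker, LinearMap.domRestrict_apply] at hy
    have hy' : y ∈ LinearMap.range i := by rw [hex]; exact hy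
    obtain ⟨x, rfl⟩ := hy'
    exact ⟨⟨x, hyT⟩, rfl⟩

/-- Exactness is preserved by restricting scalars to `ℚ`. [folklore] -/
theorem range_restrictScalars_eq_ker {i : LinTangent a₀ a₁ →ₗ[ℂ] LinTangent d₀ d₁}
    {s : LinTangent d₀ d₁ →ₗ[ℂ] LinTangent d₀' d₁'} (hex : LinearMap.range i = LinearMap.ker s) :
    LinearMap.range (i.restrictScalars ℚ) = LinearMap.ker (s.restrictScalars ℚ) := by
  ext x
  rw [LinearMap.mem_ker, LinearMap.restrictScalars_apply, ← LinearMap.mem_ker, ← hex,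
    LinearMap.mem_range, LinearMap.mem_range]
  rfl

/-! ### `Ω` under morphisms -/

/-- Membership in `Ω = 0 × ωℚ^{d₁}`: `v.1 = 0` and every `v.2 j ∈ ℚ ω` (`ω = 2πi`).
[cite: Roy1992, §1 Theorem 1 (p. 25)] -/
theorem mem_omega_iff {v : LinTangent d₀ d₁} :
    v ∈ Omega d₀ d₁ ↔ v.1 = 0 ∧ ∀ j, v.2 j ∈ (ℚ ∙ (2 * (Real.pi : ℂ) * I) : Submodule ℚ ℂ) := by
  constructor
  · intro hv
    induction hv using Submodule.span_induction with
    | mem x hx =>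
      obtain ⟨j, rfl⟩ := hx
      refine ⟨rfl, fun j' => ?_⟩
      show (Pi.single j (2 * (Real.pi : ℂ) * I) : Fin d₁ → ℂ) j' ∈ _
      by_cases h : j' = j
      · subst h
        rw [Pi.single_eq_same]
        exact Submodule.mem_span_singleton_self _
      · rw [Pi.single_eq_of_ne h]
        exact zero_mem _
    | zero => exact ⟨rfl, fun _ => zero_mem _⟩
    | add x y _ _ hx hy =>
      exact ⟨by rw [Prod.fst_add, hx.1, hy.1, add_zero], fun j => add_mem (hx.2 j) (hy.2 j)⟩
    | smul c x _ hx =>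
      refine ⟨by rw [Prod.smul_fst, hx.1, smul_zero], fun j => ?_⟩
      rw [Prod.smul_snd, Pi.smul_apply]
      exact Submodule.smul_mem _ _ (hx.2 j)
  · rintro ⟨h1, h2⟩
    have hv : v = ∑ j, ((0 : Fin d₀ → ℂ), Pi.single j (v.2 j)) := by
      ext k
      · rw [h1, Prod.fst_sum]
        simp
      · rw [Prod.snd_sum]
        simp
    rw [hv]
    refine Submodule.sum_mem _ fun j _ => ?_
    obtain ⟨a, ha⟩ := Submodule.mem_span_singleton.1 (h2 j)
    have : ((0 : Fin d₀ → ℂ), (Pi.single j (v.2 j) : Fin d₁ → ℂ)) =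
        a • ((0 : Fin d₀ → ℂ), (Pi.single j (2 * (Real.pi : ℂ) * I) : Fin d₁ → ℂ)) := by
      ext k
      · simp
      · by_cases hk : k = j
        · subst hk
          simp [ha]
        · simp [hk]
    rw [this]
    exact Submodule.smul_mem _ _ (Submodule.subset_span ⟨j, rfl⟩)

/-- A matrix with rational entries preserves "all coordinates in the `ℚ`-subspace `S`". [folklore] -/
theorem mulVec_mem_of_forall_mem {m n : ℕ} (S : Submodule ℚ ℂ) (C : Matrix (Fin m) (Fin n) ℚ)
    {z : Fin n → ℂ} (hz : ∀ k, z k ∈ S) (j : Fin m) :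
    (C.map (algebraMap ℚ ℂ)).mulVec z j ∈ S := by
  simp only [Matrix.mulVec, dotProduct, Matrix.map_apply]
  refine sum_mem fun k _ => ?_
  rw [Algebra.algebraMap_eq_smul_one, smul_mul_assoc, one_mul]
  exact Submodule.smul_mem _ _ (hz k)

/-- Morphisms map `Ω` into `Ω'` ("`s(Y ∩ Ω) ⊂ Y' ∩ Ω'`"). [cite: Roy1992, §2 proof of Proposition 2 (p. 28)] -/
theorem IsBiRational.map_omega_le {s : LinTangent d₀ d₁ →ₗ[ℂ] LinTangent d₀' d₁'}
    (hs : IsBiRational s) : (Omega d₀ d₁).map (s.restrictScalars ℚ) ≤ Omega d₀' d₁' := by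
  obtain ⟨A₀, A₁, hdec⟩ := exists_eq_prodMap_of_isBiRational hs
  rintro _ ⟨v, hv, rfl⟩
  obtain ⟨h1, h2⟩ := mem_omega_iff.1 hv
  rw [mem_omega_iff, LinearMap.restrictScalars_apply, hdec, LinearMap.prodMap_apply, h1, map_zero]
  exact ⟨rfl, fun j => mulVec_mem_of_forall_mem _ A₁ h2 j⟩

/-- Injective morphisms pull `Ω` back into `Ω*` ("`i⁻¹(Y ∩ Ω) = Y* ∩ Ω*`").
[cite: Roy1992, §2 proof of Proposition 2 (p. 28)] -/
theorem IsBiRational.comap_omega_le {i : LinTangent a₀ a₁ →ₗ[ℂ] LinTangent d₀ d₁}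
    (hi : IsBiRational i) (hinj : Function.Injective i) :
    (Omega d₀ d₁).comap (i.restrictScalars ℚ) ≤ Omega a₀ a₁ := by
  obtain ⟨B₀, B₁, hdec⟩ := exists_eq_prodMap_of_isBiRational hi
  intro x hx
  rw [Submodule.mem_comap, LinearMap.restrictScalars_apply] at hx
  obtain ⟨h1, h2⟩ := mem_omega_iff.1 hx
  have hinj₀ : Function.Injective (B₀.map (algebraMap ℚbar ℂ)).mulVecLin := by
    intro z z' hzz'
    have : i (z, 0) = i (z', 0) := by
      rw [hdec, LinearMap.prodMap_apply, LinearMap.prodMap_apply, hzz']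
    exact congrArg Prod.fst (hinj this)
  have hinj₁ : Function.Injective (B₁.map (algebraMap ℚ ℂ)).mulVecLin := by
    intro z z' hzz'
    have : i (0, z) = i (0, z') := by
      rw [hdec, LinearMap.prodMap_apply, LinearMap.prodMap_apply, hzz']
    exact congrArg Prod.snd (hinj this)
  obtain ⟨C₁, hC₁⟩ := exists_leftInverse_map B₁ hinj₁
  rw [mem_omega_iff]
  refine ⟨?_, fun j => ?_⟩
  · apply hinj₀
    rw [map_zero]
    have : (i x).1 = (B₀.map (algebraMap ℚbar ℂ)).mulVecLin x.1 := by
      rw [hdec, LinearMap.prodMap_apply]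
    rw [← this, h1]
  · have hx2 : x.2 = (C₁.map (algebraMap ℚ ℂ)).mulVec ((i x).2) := by
      rw [hdec]
      simp only [LinearMap.prodMap_apply, Matrix.mulVecLin_apply, Matrix.mulVec_mulVec, hC₁,
        Matrix.one_mulVec]
    rw [hx2]
    exact mulVec_mem_of_forall_mem _ C₁ h2 j

/-! ### Exact triples of `𝒞`: the dimensions -/

namespace Obj

/-- Along an exact triple `(X*, X, X')` the dimensions add: `d₀ = d₀* + d₀'`, `d₁ = d₁* + d₁'`
(blockwise rank–nullity). [cite: Roy1992, §2 Proposition 2 (p. 28)] -/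
theorem dims_of_exact {A X B : Obj} {i : LinTangent A.d₀ A.d₁ →ₗ[ℂ] LinTangent X.d₀ X.d₁}
    {s : LinTangent X.d₀ X.d₁ →ₗ[ℂ] LinTangent B.d₀ B.d₁} (hi : A.IsKerMap X i)
    (hs : X.IsCokerMap B s) (hex : LinearMap.range i = LinearMap.ker s) :
    A.d₀ + B.d₀ = X.d₀ ∧ A.d₁ + B.d₁ = X.d₁ := by
  obtain ⟨hinj, hbi, -, -, -⟩ := hi
  obtain ⟨⟨hsurj, hbs⟩, -, -, -⟩ := hs
  obtain ⟨B₀, B₁, hdi⟩ := exists_eq_prodMap_of_isBiRational hbi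
  obtain ⟨A₀, A₁, hds⟩ := exists_eq_prodMap_of_isBiRational hbs
  rw [hdi, hds, LinearMap.range_prodMap, LinearMap.ker_prodMap] at hex
  have hex₀ := congrArg (Submodule.map (LinearMap.fst ℂ _ _)) hex
  rw [Submodule.prod_map_fst, Submodule.prod_map_fst] at hex₀
  have hex₁ := congrArg (Submodule.map (LinearMap.snd ℂ _ _)) hex
  rw [Submodule.prod_map_snd, Submodule.prod_map_snd] at hex₁
  have hinj₀ : Function.Injective (B₀.map (algebraMap ℚbar ℂ)).mulVecLin := by
    intro z z' hzz'
    have : i (z, 0) = i (z', 0) := by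
      rw [hdi, LinearMap.prodMap_apply, LinearMap.prodMap_apply, hzz']
    exact congrArg Prod.fst (hinj this)
  have hinj₁ : Function.Injective (B₁.map (algebraMap ℚ ℂ)).mulVecLin := by
    intro z z' hzz'
    have : i (0, z) = i (0, z') := by
      rw [hdi, LinearMap.prodMap_apply, LinearMap.prodMap_apply, hzz']
    exact congrArg Prod.snd (hinj this)
  have hsurj₀ : Function.Surjective (A₀.map (algebraMap ℚbar ℂ)).mulVecLin := by
    intro z
    obtain ⟨⟨x, y⟩, h⟩ := hsurj (z, 0)
    refine ⟨x, ?_⟩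
    rw [hds, LinearMap.prodMap_apply] at h
    exact congrArg Prod.fst h
  have hsurj₁ : Function.Surjective (A₁.map (algebraMap ℚ ℂ)).mulVecLin := by
    intro z
    obtain ⟨⟨x, y⟩, h⟩ := hsurj (0, z)
    refine ⟨y, ?_⟩
    rw [hds, LinearMap.prodMap_apply] at h
    exact congrArg Prod.snd h
  have r₀ := LinearMap.finrank_range_add_finrank_ker (A₀.map (algebraMap ℚbar ℂ)).mulVecLin
  rw [LinearMap.range_eq_top.2 hsurj₀, finrank_top, ← hex₀,
    LinearMap.finrank_range_of_inj hinj₀] at r₀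
  have r₁ := LinearMap.finrank_range_add_finrank_ker (A₁.map (algebraMap ℚ ℂ)).mulVecLin
  rw [LinearMap.range_eq_top.2 hsurj₁, finrank_top, ← hex₁,
    LinearMap.finrank_range_of_inj hinj₁] at r₁
  simp only [finrank_fin_fun] at r₀ r₁
  omega

/-- Along an exact triple, `dim V = dim V* + dim V'` and `dim W = dim W* + dim W'`.
[cite: Roy1992, §2 proof of Proposition 2 (p. 28)] -/
theorem finrank_VW_of_exact {A X B : Obj} {i : LinTangent A.d₀ A.d₁ →ₗ[ℂ] LinTangent X.d₀ X.d₁}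
    {s : LinTangent X.d₀ X.d₁ →ₗ[ℂ] LinTangent B.d₀ B.d₁} (hi : A.IsKerMap X i)
    (hs : X.IsCokerMap B s) (hex : LinearMap.range i = LinearMap.ker s) :
    finrank ℂ B.V + finrank ℂ A.V = finrank ℂ X.V ∧
      finrank ℂ B.W + finrank ℂ A.W = finrank ℂ X.W := by
  obtain ⟨hinj, -, -, hW, hV⟩ := hi
  obtain ⟨-, -, hW', hV'⟩ := hs
  rw [hV, hW, hV', hW']
  exact ⟨finrank_map_add_finrank_comap i s hinj hex X.V,
    finrank_map_add_finrank_comap i s hinj hex X.W⟩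

/-- Along an exact triple, `dim_ℚ Y = dim_ℚ Y* + dim_ℚ Y'`. [cite: Roy1992, §2 proof of Proposition 2 (p. 28)] -/
theorem finrank_Y_of_exact {A X B : Obj} {i : LinTangent A.d₀ A.d₁ →ₗ[ℂ] LinTangent X.d₀ X.d₁}
    {s : LinTangent X.d₀ X.d₁ →ₗ[ℂ] LinTangent B.d₀ B.d₁} (hi : A.IsKerMap X i)
    (hs : X.IsCokerMap B s) (hex : LinearMap.range i = LinearMap.ker s) :
    finrank ℚ B.Y + finrank ℚ A.Y = finrank ℚ X.Y := by
  obtain ⟨hinj, -, hY, -, -⟩ := hi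
  obtain ⟨-, hY', -, -⟩ := hs
  rw [hY, hY']
  exact finrank_map_add_finrank_comap (i.restrictScalars ℚ) (s.restrictScalars ℚ) hinj
    (range_restrictScalars_eq_ker hex) X.Y

/-- Along an exact triple, `dim_ℚ(Y ∩ Ω) ≤ dim_ℚ(Y* ∩ Ω*) + dim_ℚ(Y' ∩ Ω')` ("the function
`d₁ − a` is lower additive"). [cite: Roy1992, §2 proof of Proposition 2 (p. 28)] -/
theorem finrank_Y_inf_omega_of_exact {A X B : Obj}
    {i : LinTangent A.d₀ A.d₁ →ₗ[ℂ] LinTangent X.d₀ X.d₁}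
    {s : LinTangent X.d₀ X.d₁ →ₗ[ℂ] LinTangent B.d₀ B.d₁} (hi : A.IsKerMap X i)
    (hs : X.IsCokerMap B s) (hex : LinearMap.range i = LinearMap.ker s) :
    finrank ℚ ↥(X.Y ⊓ Omega X.d₀ X.d₁) ≤
      finrank ℚ ↥(A.Y ⊓ Omega A.d₀ A.d₁) + finrank ℚ ↥(B.Y ⊓ Omega B.d₀ B.d₁) := by
  obtain ⟨hinj, hbi, hY, -, -⟩ := hi
  obtain ⟨⟨-, hbs⟩, hY', -, -⟩ := hs
  set T := X.Y ⊓ Omega X.d₀ X.d₁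
  haveI : Module.Finite ℚ T :=
    Module.Finite.of_injective (Submodule.inclusion inf_le_left) (Submodule.inclusion_injective _)
  have h := finrank_map_add_finrank_comap (i.restrictScalars ℚ) (s.restrictScalars ℚ) hinj
    (range_restrictScalars_eq_ker hex) T
  have h1 : T.map (s.restrictScalars ℚ) ≤ B.Y ⊓ Omega B.d₀ B.d₁ := by
    rw [hY']
    exact le_inf (Submodule.map_mono inf_le_left)
      ((Submodule.map_mono inf_le_right).trans (IsBiRational.map_omega_le hbs))
  have h2 : T.comap (i.restrictScalars ℚ) ≤ A.Y ⊓ Omega A.d₀ A.d₁ := by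
    rw [hY]
    exact le_inf (Submodule.comap_mono inf_le_left)
      ((Submodule.comap_mono inf_le_right).trans (hbi.comap_omega_le hinj))
  haveI : Module.Finite ℚ ↥(B.Y ⊓ Omega B.d₀ B.d₁) :=
    Module.Finite.of_injective (Submodule.inclusion inf_le_left) (Submodule.inclusion_injective _)
  haveI : Module.Finite ℚ ↥(A.Y ⊓ Omega A.d₀ A.d₁) :=
    Module.Finite.of_injective (Submodule.inclusion inf_le_left) (Submodule.inclusion_injective _)
  have h1' := LinearMap.finrank_le_finrank_of_injective (Submodule.inclusion_injective h1)
  have h2' := LinearMap.finrank_le_finrank_of_injective (Submodule.inclusion_injective h2)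
  omega

/-! ### Proposition 2 -/

/-- `r = d₀ + d₁` is additive. [cite: Roy1992, §2 Proposition 2 (p. 28)] -/
theorem fr_additive : cat.Additive fr := by
  rintro A X B ⟨i, s, hi, hs, hex⟩
  have := dims_of_exact hi hs hex
  unfold fr
  omega

/-- `d₀` is additive. [cite: Roy1992, §2 Proposition 2 (p. 28)] -/
theorem fd₀_additive : cat.Additive fd₀ := by
  rintro A X B ⟨i, s, hi, hs, hex⟩
  have := dims_of_exact hi hs hex
  unfold fd₀
  omega

/-- `d₁` is additive. [cite: Roy1992, §2 Proposition 2 (p. 28)] -/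
theorem fd₁_additive : cat.Additive fd₁ := by
  rintro A X B ⟨i, s, hi, hs, hex⟩
  have := dims_of_exact hi hs hex
  unfold fd₁
  omega

/-- `b = d₀ + d₁ − dim V` is additive. [cite: Roy1992, §2 Proposition 2 (p. 28)] -/
theorem fb_additive : cat.Additive fb := by
  rintro A X B ⟨i, s, hi, hs, hex⟩
  have h1 := dims_of_exact hi hs hex
  have h2 := (finrank_VW_of_exact hi hs hex).1
  have h3 := A.finrank_V_le
  have h4 := B.finrank_V_le
  unfold fb
  omega

/-- `c = dim_ℚ Y` is additive. [cite: Roy1992, §2 Proposition 2 (p. 28)] -/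
theorem fc_additive : cat.Additive fc := by
  rintro A X B ⟨i, s, hi, hs, hex⟩
  have := finrank_Y_of_exact hi hs hex
  unfold fc
  omega

/-- `d = dim V − dim W` is additive. [cite: Roy1992, §2 Proposition 2 (p. 28)] -/
theorem fd_additive : cat.Additive fd := by
  rintro A X B ⟨i, s, hi, hs, hex⟩
  have h1 := finrank_VW_of_exact hi hs hex
  have h3 := A.finrank_W_le
  have h4 := B.finrank_W_le
  have h5 := X.finrank_W_le
  unfold fd
  omega

/-- `a = d₁ − dim_ℚ(Y ∩ Ω)` is upper additive. [cite: Roy1992, §2 Proposition 2 (p. 28)] -/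
theorem fa_upperAdditive : cat.UpperAdditive fa := by
  rintro A X B ⟨i, s, hi, hs, hex⟩
  have h1 := dims_of_exact hi hs hex
  have h2 := finrank_Y_inf_omega_of_exact hi hs hex
  have h3 := A.finrank_Y_inf_omega_le
  have h4 := B.finrank_Y_inf_omega_le
  have h5 := X.finrank_Y_inf_omega_le
  unfold fa
  omega

/-- `a, b, c, d` vanish where `r` vanishes (`d₀ = d₁ = 0`: the ambient space is zero).
[cite: Roy1992, §2 Proposition 2 (p. 28)] -/
theorem vanish (X : Obj) (hr : fr X = 0) : fa X = 0 ∧ fb X = 0 ∧ fc X = 0 ∧ fd X = 0 := by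
  have hd₀ : X.d₀ = 0 := by unfold fr at hr; omega
  have hd₁ : X.d₁ = 0 := by unfold fr at hr; omega
  have h0 : ∀ v : LinTangent X.d₀ X.d₁, v = 0 := fun v =>
    Prod.ext (funext fun k => (Fin.cast hd₀ k).elim0) (funext fun k => (Fin.cast hd₁ k).elim0)
  have hY : X.Y = ⊥ := (Submodule.eq_bot_iff _).2 fun v _ => h0 v
  have hV : X.V = ⊥ := (Submodule.eq_bot_iff _).2 fun v _ => h0 v
  refine ⟨?_, ?_, ?_, ?_⟩
  · unfold fa; omega
  · unfold fb; omega
  · unfold fc; rw [hY, finrank_bot]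
  · unfold fd; rw [hV, finrank_bot]; omega

/-- **Proposition 2** as the hypotheses of Theorem 3 for `(𝒞, a, b, c, d, r)`.
[cite: Roy1992, §2 Proposition 2 (p. 28); §3 proof of Theorem 2bis (p. 32)] -/
theorem thm3Hyp : cat.Thm3Hyp fa fb fc fd fr where
  ha := fa_upperAdditive
  hb := fb_additive
  hc := fc_additive
  hd := fun _ _ _ hE => (fd_additive hE).ge
  hr := fr_additive
  vanish := vanish

/-! ### Proposition 3 -/

/-- **Proposition 3**: "For each object `X` of `𝒞`, there exists a cokernel `s : X → X'` with
domain `X` such that `d₁(X') ≤ a(X)` and `b(X') = b(X)`" — `s = id × t₁` with `t₁` a rational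
surjection of kernel `K·(V ∩ (0 × ℚ^{d₁}))`; then `d₁' = d₁ − dim_K(V ∩ (0 × ℚ^{d₁})) ≤ d₁ −
dim_ℚ(Y ∩ Ω)` and `ker(s) ⊂ V`. [cite: Roy1992, §2 Proposition 3 (pp. 28–29)] -/
theorem prop3 (X : Obj) : ∃ X', cat.IsCoker X X' ∧ fd₁ X' ≤ fa X ∧ fb X' = fb X := by
  -- `S₁` = the rational `q` with `(0, q) ∈ V`
  let ι : (Fin X.d₁ → ℚ) →ₗ[ℚ] LinTangent X.d₀ X.d₁ :=
    ((LinearMap.inr ℂ (Fin X.d₀ → ℂ) (Fin X.d₁ → ℂ)).restrictScalars ℚ) ∘ₗ incl ℚ ℂ X.d₁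
  have hι : ∀ q, ι q = (0, incl ℚ ℂ X.d₁ q) := fun q => rfl
  let S₁ : Submodule ℚ (Fin X.d₁ → ℚ) := (X.V.restrictScalars ℚ).comap ι
  have hS₁ : ∀ q, q ∈ S₁ ↔ ((0 : Fin X.d₀ → ℂ), incl ℚ ℂ X.d₁ q) ∈ X.V := fun q => Iff.rfl
  obtain ⟨d₁', A₁, hdim, hsurj₁, hker₁⟩ := exists_surjective_ker_eq_spanK (F := ℚ) (K := ℂ) S₁
  -- `s = id × t₁`
  set s : LinTangent X.d₀ X.d₁ →ₗ[ℂ] LinTangent X.d₀ d₁' :=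
    ((1 : Matrix (Fin X.d₀) (Fin X.d₀) ℚbar).map (algebraMap ℚbar ℂ)).mulVecLin.prodMap
      (A₁.map (algebraMap ℚ ℂ)).mulVecLin with hs_def
  have hbr : IsBiRational s := isBiRational_prodMap 1 A₁
  have hone : ((1 : Matrix (Fin X.d₀) (Fin X.d₀) ℚbar).map (algebraMap ℚbar ℂ)).mulVecLin =
      LinearMap.id := by
    rw [Matrix.map_one _ (map_zero _) (map_one _), Matrix.mulVecLin_one]
  have hs : IsAdmissible s := by
    refine ⟨?_, hbr⟩
    rw [hs_def, hone, LinearMap.coe_prodMap]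
    exact Function.surjective_id.prodMap hsurj₁
  have hker_s : LinearMap.ker s = (⊥ : Submodule ℂ (Fin X.d₀ → ℂ)).prod (spanK ℂ S₁) := by
    rw [hs_def, LinearMap.ker_prodMap, hone, LinearMap.ker_id, hker₁]
  have hker_le : LinearMap.ker s ≤ X.V := by
    rw [hker_s]
    rintro ⟨x, y⟩ ⟨hx, hy⟩
    change x ∈ (⊥ : Submodule ℂ _) at hx
    rw [Submodule.mem_bot] at hx
    subst hx
    change y ∈ spanK ℂ S₁ at hy
    have hle : (spanK ℂ S₁).map (LinearMap.inr ℂ (Fin X.d₀ → ℂ) (Fin X.d₁ → ℂ)) ≤ X.V := by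
      rw [spanK, Submodule.map_span, Submodule.span_le]
      rintro _ ⟨_, ⟨q, hq, rfl⟩, rfl⟩
      exact (hS₁ q).1 hq
    exact hle ⟨y, hy, rfl⟩
  have hfinker : finrank ℂ (LinearMap.ker s) = finrank ℚ S₁ := by
    rw [hker_s, finrank_prod_eq, finrank_bot, finrank_spanK, zero_add]
  have hmap : finrank ℂ (X.V.map s) + finrank ℂ (LinearMap.ker s) = finrank ℂ X.V := by
    rw [finrank_map_add_finrank_ker, sup_eq_left.2 hker_le]
  have hkerV : finrank ℂ (LinearMap.ker s) ≤ finrank ℂ X.V := Submodule.finrank_mono hker_le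
  -- `dim_ℚ(Y ∩ Ω) ≤ dim_ℚ S₁`: `Y ∩ Ω ⊆ Ω ∩ V = θ(S₁)`, `θ(q) = ω (0, q)`
  have hm : finrank ℚ ↥(X.Y ⊓ Omega X.d₀ X.d₁) ≤ finrank ℚ S₁ := by
    let θ : (Fin X.d₁ → ℚ) →ₗ[ℚ] LinTangent X.d₀ X.d₁ := (2 * (Real.pi : ℂ) * I) • ι
    have hθ : ∀ q, θ q = (2 * (Real.pi : ℂ) * I) • ((0 : Fin X.d₀ → ℂ), incl ℚ ℂ X.d₁ q) :=
      fun q => rfl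
    have hle : X.Y ⊓ Omega X.d₀ X.d₁ ≤ S₁.map θ := by
      rintro v ⟨hvY, hvΩ⟩
      obtain ⟨h1, h2⟩ := mem_omega_iff.1 hvΩ
      choose a ha using fun j => Submodule.mem_span_singleton.1 (h2 j)
      have hv : v = θ a := by
        ext k
        · simp [h1, hθ]
        · have e1 : (θ a).2 k = (2 * (Real.pi : ℂ) * I) * ((a k : ℚ) : ℂ) := by simp [hθ]
          rw [e1, ← ha k, Rat.smul_def, mul_comm]
      refine ⟨a, ?_, hv.symm⟩
      show ((0 : Fin X.d₀ → ℂ), incl ℚ ℂ X.d₁ a) ∈ X.V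
      have : ((0 : Fin X.d₀ → ℂ), incl ℚ ℂ X.d₁ a) = (2 * (Real.pi : ℂ) * I)⁻¹ • v := by
        rw [hv, hθ, inv_smul_smul₀ Complex.two_pi_I_ne_zero]
      rw [this]
      exact X.V.smul_mem _ (X.hYV hvY)
    exact (LinearMap.finrank_le_finrank_of_injective (Submodule.inclusion_injective hle)).trans
      (Submodule.finrank_map_le θ S₁)
  refine ⟨X.mapObj s hbr, ⟨s, X.isCokerMap_mapObj hs⟩, ?_, ?_⟩
  · show d₁' ≤ X.d₁ - finrank ℚ ↥(X.Y ⊓ Omega X.d₀ X.d₁)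
    omega
  · show X.d₀ + d₁' - finrank ℂ (X.V.map s) = X.d₀ + X.d₁ - finrank ℂ X.V
    omega

/-! ### Theorem 1bis -/

/-- **Theorem 1bis**: Statement 1 of Theorem 3 holds for `(𝒞, a, b, c, d, r)` — it is Theorem 1.
[cite: Roy1992, §2 Theorem 1bis (p. 27); §3 proof of Theorem 2bis (p. 32)] -/
theorem statement1_of_thm1 (h : roy1992_thm1) : cat.Statement1 fa fb fc fd fr := by
  intro X hb
  obtain ⟨d₀', d₁', s, hs, hne, hineq⟩ := exists_mapObj_of_thm1 h X hb
  exact ⟨X.mapObj s hs.2, ⟨s, X.isCokerMap_mapObj hs⟩, hne, hineq⟩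

end Obj

end PartC

end Literature.Barriers.Schanuel.Roy1992
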